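import Summits.AtomisticToContinuum.FouriersLaw.Theses.BoundaryEscapeDeficit
import Summits.AtomisticToContinuum.FouriersLaw.Theorems.BoundedResponseConverges.Negative.OscillationExcluded

/-!
# Birth skeleton (`Lines/birth.lean`) for crux `EscapeNonOscillation` (stmt-AtomisticToContinuum-12238)

Route `BoundaryEscapeDeficit` (sub-problem `FouriersLaw`), crux r5 `EscapeNonOscillation` = NON-OSCILLATION OF
THE ESCAPE DEFICIT: for `P = pinnedChain ω₂ lam β γ` (all four `> 0`) and `T > 0`, the real sequence
`N ↦ (N-1)·γ·E_N` has a limit in `EReal = [-∞, ∞]`, where `E_N = 1 - (γ/T²)∫_{u>0} K_N(u)` is the ESCAPE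
DEFICIT of the `N`-site chain and `K_N(u) = ∫ (p_0²-T)·P_u^{N,T,T}(p_0²-T) dμ_T^N` the equilibrium
autocorrelation of the boundary kinetic energy (constructed kernels `P.transitionKernel N T T u⁺`, Gibbs state
`P.gibbsMeasure N T`; `N = 0`: kernel `0` by the route's convention). An EQUILIBRIUM statement: no steady
state, no uniqueness, no response coefficient appears in it.

## The line: THE SERIES LAW AT EQUILIBRIUM (Fekete on the resistance `R_N = 1/(γ E_N)`) — two stubs

Read `G_N := γ·E_N` as the bath-to-bath CONDUCTANCE of the `N`-site chain (it IS the per-bond current response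
`J̃/δ`, by the landed response identity `D_N = (N-1)·γ·E_N`, but nothing below uses that) and `R_N := 1/(γ E_N)`
as its RESISTANCE.

* `stub_escapeDeficitPos` — POSITIVITY OF THE ESCAPE DEFICIT: `E_N > 0` for every `N ≥ 2` (a spontaneous
  boundary energy fluctuation of the finite chain is NOT entirely returned to the near bath: `(γ/T²)∫K_N < 1`;
  equivalently the conductance is positive). Size M. Supply map available NOW from landed theorems (D-side):
  `FeketeSeriesLaw.PositiveConductance` (stmt-11750, `positiveConductance_holds`) gives `D_N > 0` (`N ≥ 2`) along the
  canonical family (`pinnedChain_exists_isSteadyState`, `NessUnique_holds`, `finiteResponseOfUnique_holds`), and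
  `responseCoeff_eq_escapeDeficit` (from the landed `responseIdentity_proof`) identifies `D_N = (N-1)·γ·E_N`, whence
  `E_N > 0`. A direct equilibrium proof (strict deficiency of the sum rule at finite `N`) is the route-internal way.
* `stub_resistanceQuasiSubadditive` — THE SERIES LAW WITH BOUNDED JUNCTION DEFECT, AT EQUILIBRIUM:
  `∃ C, ∀ n m ≥ 2, R_{n+m} ≤ R_n + R_m + C`. Joining an `n`-chain and an `m`-chain (removing the two facing bath
  contacts, adding one anharmonic bond) raises the resistance by at most a contact constant. This is the E-form of
  `FeketeSeriesLaw.QuasiSubadditiveResistance` (stmt-14041, open, XL; same index set `{n, m ≥ 2}`, and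
  `(N-1)/D_N = 1/(γE_N)` by the response identity, so 14041 ⇒ this stub by landed bridges), but it is stated on ONE
  equilibrium scalar per length and is implied by MONOTONE SATURATION of the finite-size conductivity
  (`N ↦ N·γ·E_N` non-decreasing ⇒ `R_N/N` non-increasing ⇒ `R` subadditive with `C = 0`) — the second engine named
  in the crux's docstring; it holds in the kinetic slab caricature for EVERY mean-free-path law (where the
  SUPERadditive sibling `JunctionLocality.SuperadditiveResistance`, stmt-11748, fails as soon as the mfp second
  moment diverges: `Cruxes/SuperadditiveResistance/Disproof.lean` §2b) and at the harmonic corner (`R_N` bounded).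
  Size L–XL (the honest hard stub).
* `EscapeNonOscillation_of` — the composition, kernel-checked here (no `sorry`): `b_n := -(R_n + C)` is
  superadditive on `{n ≥ 2}` with slopes `≤ |C|/2`, so the landed Fekete lemma on the index semigroup `{n ≥ 2}`
  (`Theorems.boundedResponseConverges_tendsto_div_of_superadditive`) gives `R_n/n → L ≥ 0`; for `n ≥ 2`,
  `(n-1)·γ·E_n = ((n-1)/n)/(R_n/n)`; if `L > 0` the limit is the real `1/L`, if `L = 0` then `R_n/n → 0⁺` and
  `(n-1)·γ·E_n → +∞ = ⊤`. Either way an `EReal` limit: the crux BY NAME.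

Hardest stub: `stub_resistanceQuasiSubadditive` (it carries all the `N`-uniform content; the assembly and
`stub_escapeDeficitPos` are respectively proved here and dischargeable from landed theorems).

## Disproof used
No `Cruxes/EscapeNonOscillation/Disproof.lean` exists (`ledger crux ls stmt-AtomisticToContinuum-12238`: no workfiles
before this one). Honoured from the siblings: `Cruxes/SuperadditiveResistance/Disproof.lean` §3
`harmonic_corner_not_superadditive` (the SUPERadditive series law fails at the harmonic corner with `C = 0`) and §2
`not_insertionBounded_of_log_correction` / `_of_rpow_correction` (slow corrections `R_N = ℓN + a + bN^s`, `b log N`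
kill SUPERadditivity) — both are reasons to state the SUBadditive direction here, which those very profiles satisfy
(`insertionBounded_of_subadditive_dip` is the mirror statement); `BoundedResponseConverges.Negative`
(`boundedResponseConverges_skeleton_oscillating`): an oscillating escape sequence is exactly what stub 2 excludes, and
at the harmonic corner both stubs HOLD with limit `⊤` (consistent with `not_fouriersLawFor_harmonic`: only the route's
Tail-upper fails there). `ledger negatives --problem AtomisticToContinuum` (20 entries, 2 on FouriersLaw:
OddCorrectorDecay, FarFieldGaussianity): nothing on resistance additivity or on the sign of `E_N`.
-/

noncomputable section

open MeasureTheory Filter Topology Set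
open scoped NNReal

namespace Summit.AtomisticToContinuum.FouriersLaw.Cruxes.EscapeNonOscillation.Birth

open Literature.MathematicalPhysics.KineticTheory.HeatConduction
open Summit.AtomisticToContinuum.FouriersLaw.Theses.BoundaryEscapeDeficit (EscapeNonOscillation)

/-! ### The registered stubs (`sorry` lives ONLY here)

Both stubs speak about the route's escape deficit `E : ℕ → ℝ`, characterised by the defining hypothesis
`∀ N, E N = 1 - (γ/T²)∫_{u>0} K_N(u)` (verbatim the `let E` / `let K` / `let P` chain of the crux, unfolded), so
that the registered signatures are closed one-line terms. -/

/-- STUB 1 `stub_escapeDeficitPos` (size M; dischargeable now from landed D-side theorems, see the module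
docstring) — POSITIVITY OF THE ESCAPE DEFICIT: for `pinnedChain ω₂ lam β γ` (all `> 0`), `T > 0` and every
`N ≥ 2`, `E_N = 1 - (γ/T²)∫_{u>0} K_N(u) > 0` (the finite chain's boundary kinetic-energy fluctuation is not
entirely returned to the near bath; = positivity of the conductance `γE_N = D_N/(N-1)`).
[cite: KunduDharNarayan2009, arXiv:0809.4543 p. 3] [cite: ReyBellet2003, Rem. 4.4] -/
theorem stub_escapeDeficitPos :
    ∀ ω₂ lam β γ : ℝ, 0 < ω₂ → 0 < lam → 0 < β → 0 < γ → ∀ T : ℝ, 0 < T → ∀ E : ℕ → ℝ,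
      (∀ N : ℕ, E N = 1 - γ / T ^ 2 * ∫ u in Ioi (0 : ℝ),
          (if h : 0 < N then
              ∫ z, ((z.2 ⟨0, h⟩) ^ 2 - T) * (∫ y, ((y.2 ⟨0, h⟩) ^ 2 - T)
                ∂((pinnedChain ω₂ lam β γ).transitionKernel N T T u.toNNReal z))
                ∂((pinnedChain ω₂ lam β γ).gibbsMeasure N T)
            else 0)) →
        ∀ N : ℕ, 2 ≤ N → 0 < E N := by
  sorry

/-- STUB 2 `stub_resistanceQuasiSubadditive` (size L–XL; the load-bearing stub) — THE SERIES LAW WITH BOUNDED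
JUNCTION DEFECT, AT EQUILIBRIUM: for `pinnedChain ω₂ lam β γ` (all `> 0`) and `T > 0` there is `C` with
`R_{n+m} ≤ R_n + R_m + C` for all `n, m ≥ 2`, `R_N := 1/(γ E_N)` the bath-to-bath resistance read off the
escape deficit. E-form of `FeketeSeriesLaw.QuasiSubadditiveResistance` (stmt-14041); implied by monotone
saturation of `N ↦ N·γ·E_N`. [cite: BonettoLebowitzReyBellet2000, §5.3 (33), §6.3]
[cite: LepriLiviPoliti2003, §6] [cite: Hammersley1988, §1] -/
theorem stub_resistanceQuasiSubadditive :
    ∀ ω₂ lam β γ : ℝ, 0 < ω₂ → 0 < lam → 0 < β → 0 < γ → ∀ T : ℝ, 0 < T → ∀ E : ℕ → ℝ,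
      (∀ N : ℕ, E N = 1 - γ / T ^ 2 * ∫ u in Ioi (0 : ℝ),
          (if h : 0 < N then
              ∫ z, ((z.2 ⟨0, h⟩) ^ 2 - T) * (∫ y, ((y.2 ⟨0, h⟩) ^ 2 - T)
                ∂((pinnedChain ω₂ lam β γ).transitionKernel N T T u.toNNReal z))
                ∂((pinnedChain ω₂ lam β γ).gibbsMeasure N T)
            else 0)) →
        ∃ C : ℝ, ∀ n m : ℕ, 2 ≤ n → 2 ≤ m →
          1 / (γ * E (n + m)) ≤ 1 / (γ * E n) + 1 / (γ * E m) + C := by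
  sorry

/-! ### By-name statements of the registered stubs

The skeleton audit (`#h21_check_skeleton`) wants the hypotheses of the crux-concluding theorem to be the declared
stubs BY NAME; `Registered.stub_x` is DEFINITIONALLY the statement of the sorried `theorem stub_x` (`type_of%`), so
`EscapeNonOscillation_of : Registered.stub_escapeDeficitPos → Registered.stub_resistanceQuasiSubadditive →
EscapeNonOscillation` is literally "stub signatures → crux", and the `example` at the end type-checks
`EscapeNonOscillation_of stub_escapeDeficitPos stub_resistanceQuasiSubadditive : EscapeNonOscillation`. -/

namespace Registered

/-- Statement of registered stub 1 (`stub_escapeDeficitPos`), by name. -/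
def stub_escapeDeficitPos : Prop := type_of% Birth.stub_escapeDeficitPos

/-- Statement of registered stub 2 (`stub_resistanceQuasiSubadditive`), by name. -/
def stub_resistanceQuasiSubadditive : Prop := type_of% Birth.stub_resistanceQuasiSubadditive

end Registered

/-! ### Sequence level (pure real analysis, no `sorry`): positivity + series law ⇒ `EReal` limit -/

/-- **Fekete for the escape sequence.** If `E n > 0` for `n ≥ 2` and the resistances `R n = 1/(γ E n)` satisfy
`R (n+m) ≤ R n + R m + C` (`n, m ≥ 2`), then `↑((n-1)·γ·E n)` converges in `EReal` — to `1/L` if the Fekete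
slope `L = lim R n / n` is positive, to `⊤` if `L = 0`. [cite: Hammersley1988, §1] -/
theorem ereal_tendsto_escape_of_quasiSubadditive {E : ℕ → ℝ} {γ C : ℝ} (hγ : 0 < γ)
    (hpos : ∀ N : ℕ, 2 ≤ N → 0 < E N)
    (hsub : ∀ n m : ℕ, 2 ≤ n → 2 ≤ m →
      1 / (γ * E (n + m)) ≤ 1 / (γ * E n) + 1 / (γ * E m) + C) :
    ∃ ℓ : EReal, Tendsto (fun N : ℕ => ((((N : ℝ) - 1) * γ * E N : ℝ) : EReal)) atTop (𝓝 ℓ) := by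
  -- resistance `R n = 1/(γ E n) > 0` for `n ≥ 2`
  have hRpos : ∀ n : ℕ, 2 ≤ n → 0 < 1 / (γ * E n) := fun n hn =>
    one_div_pos.2 (mul_pos hγ (hpos n hn))
  -- Fekete on `{n ≥ 2}` for the superadditive `b n := -(R n + C)`, slopes `≤ |C|/2`
  set b : ℕ → ℝ := fun n => -(1 / (γ * E n) + C) with hb
  have hsup : ∀ n m : ℕ, 2 ≤ n → 2 ≤ m → b n + b m ≤ b (n + m) := by
    intro n m hn hm
    have h := hsub n m hn hm
    simp only [hb]
    linarith
  have hM : ∀ n : ℕ, 2 ≤ n → b n / n ≤ |C| / 2 := by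
    intro n hn
    have hn0 : (0 : ℝ) < n := by exact_mod_cast (by omega : 0 < n)
    have hn2 : (2 : ℝ) ≤ n := by exact_mod_cast hn
    have ha := hRpos n hn
    have hC : -C ≤ |C| := neg_le_abs C
    rw [div_le_iff₀ hn0]
    simp only [hb]
    nlinarith [abs_nonneg C]
  obtain ⟨s, hs, -⟩ :=
    Summit.AtomisticToContinuum.FouriersLaw.Theorems.boundedResponseConverges_tendsto_div_of_superadditive
      hsup hM
  -- slopes of the resistance: `R n / n → -s`
  have hC0 : Tendsto (fun n : ℕ => C / (n : ℝ)) atTop (𝓝 0) := tendsto_const_div_atTop_nhds_zero_nat C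
  have hRn : Tendsto (fun n : ℕ => (1 / (γ * E n)) / n) atTop (𝓝 (-s)) := by
    have hlim : Tendsto (fun n : ℕ => -(b n / n) - C / n) atTop (𝓝 (-s - 0)) := hs.neg.sub hC0
    rw [sub_zero] at hlim
    refine hlim.congr' ?_
    filter_upwards [eventually_gt_atTop 0] with n hn
    have hn0 : (n : ℝ) ≠ 0 := by exact_mod_cast hn.ne'
    simp only [hb]
    field_simp
    ring
  have hslope : ∀ n : ℕ, 2 ≤ n → 0 < (1 / (γ * E n)) / n := fun n hn => by
    have hn0 : (0 : ℝ) < n := by exact_mod_cast (by omega : 0 < n)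
    exact div_pos (hRpos n hn) hn0
  have hL0 : 0 ≤ -s :=
    ge_of_tendsto hRn ((eventually_ge_atTop 2).mono fun n hn => (hslope n hn).le)
  -- the escape sequence for `n ≥ 2`: `(n-1)·γ·E n = ((n-1)/n) / (R n / n)`
  have hkey : ∀ n : ℕ, 2 ≤ n →
      ((n : ℝ) - 1) * γ * E n = (((n : ℝ) - 1) / n) / ((1 / (γ * E n)) / n) := by
    intro n hn
    have hn0 : (n : ℝ) ≠ 0 := by exact_mod_cast (by omega : n ≠ 0)
    have hE0 : E n ≠ 0 := (hpos n hn).ne'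
    have hγ0 : γ ≠ 0 := hγ.ne'
    field_simp
  -- `(n-1)/n → 1`
  have hone : Tendsto (fun n : ℕ => ((n : ℝ) - 1) / n) atTop (𝓝 1) := by
    have h : Tendsto (fun n : ℕ => (1 : ℝ) - 1 / n) atTop (𝓝 (1 - 0)) :=
      tendsto_const_nhds.sub tendsto_one_div_atTop_nhds_zero_nat
    rw [sub_zero] at h
    refine h.congr' ?_
    filter_upwards [eventually_gt_atTop 0] with n hn
    have hn0 : (n : ℝ) ≠ 0 := by exact_mod_cast hn.ne'
    field_simp
  rcases hL0.lt_or_eq with hLpos | hLzero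
  · -- positive Fekete slope: real limit `1/L`
    refine ⟨((1 / (-s) : ℝ) : EReal), EReal.tendsto_coe.2 ?_⟩
    have hlim : Tendsto (fun n : ℕ => (((n : ℝ) - 1) / n) / ((1 / (γ * E n)) / n)) atTop
        (𝓝 (1 / (-s))) := hone.div hRn hLpos.ne'
    refine hlim.congr' ?_
    filter_upwards [eventually_ge_atTop 2] with n hn
    exact (hkey n hn).symm
  · -- zero slope: `R n / n → 0⁺`, so `(n-1)·γ·E n → +∞ = ⊤`
    refine ⟨⊤, EReal.tendsto_coe_nhds_top_iff.2 ?_⟩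
    have hinv : Tendsto (fun n : ℕ => ((1 / (γ * E n)) / n)⁻¹) atTop atTop := by
      refine tendsto_inv_nhdsGT_zero.comp ?_
      rw [← hLzero] at hRn
      refine tendsto_nhdsWithin_iff.2 ⟨hRn, ?_⟩
      filter_upwards [eventually_ge_atTop 2] with n hn
      exact hslope n hn
    have hlim : Tendsto (fun n : ℕ => (((n : ℝ) - 1) / n) * ((1 / (γ * E n)) / n)⁻¹) atTop atTop :=
      hone.pos_mul_atTop one_pos hinv
    refine hlim.congr' ?_
    filter_upwards [eventually_ge_atTop 2] with n hn
    rw [hkey n hn]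
    ring

/-! ### The composition (kernel-checked, no `sorry`): the two stubs give the crux BY NAME -/

/-- `stub_escapeDeficitPos → stub_resistanceQuasiSubadditive → EscapeNonOscillation`: introduce the crux's
`let`-bound `P`, `K`, `E`; the defining hypothesis of the stubs is `rfl` for this `E`; feed both stubs to the
sequence-level Fekete lemma. [folklore] -/
theorem EscapeNonOscillation_of (h1 : Registered.stub_escapeDeficitPos)
    (h2 : Registered.stub_resistanceQuasiSubadditive) : EscapeNonOscillation := by
  intro ω₂ lam β γ hω hl hβ hγ T hT P K E
  -- the `let`-bound escape deficit, read back as the closed expression the stubs quantify over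
  have hE : ∀ N : ℕ, E N = 1 - γ / T ^ 2 * ∫ u in Ioi (0 : ℝ),
      (if h : 0 < N then
          ∫ z, ((z.2 ⟨0, h⟩) ^ 2 - T) * (∫ y, ((y.2 ⟨0, h⟩) ^ 2 - T)
            ∂((pinnedChain ω₂ lam β γ).transitionKernel N T T u.toNNReal z))
            ∂((pinnedChain ω₂ lam β γ).gibbsMeasure N T)
        else 0) := fun N => rfl
  have hpos : ∀ N : ℕ, 2 ≤ N → 0 < E N := h1 ω₂ lam β γ hω hl hβ hγ T hT E hE
  obtain ⟨C, hC⟩ := h2 ω₂ lam β γ hω hl hβ hγ T hT E hE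
  exact ereal_tendsto_escape_of_quasiSubadditive hγ hpos hC

/-- Type-check (not a declaration): the sorried stubs are literally the antecedents of `EscapeNonOscillation_of`
(conditional on the stubs; an `example`, so it adds nothing to the environment). -/
example : EscapeNonOscillation := EscapeNonOscillation_of stub_escapeDeficitPos stub_resistanceQuasiSubadditive

end Summit.AtomisticToContinuum.FouriersLaw.Cruxes.EscapeNonOscillation.Birth

end
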